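import Mathlib
import Literature.MathematicalPhysics.QuantumManyBody.BoseEinsteinCondensation
import Summits.AtomisticToContinuum.BoseEinsteinCondensation.Theorems.SoloBlindBhattacharyya
import Summits.AtomisticToContinuum.BoseEinsteinCondensation.Theorems.SoloBlindEntropicPenroseOnsager

/-!
# Exponential (Jensen) form of the entropic Penrose–Onsager criterion

Solo seat `solo-AtomisticToContinuum-blind`, conjunct `BoseEinsteinCondensation`; sequel to
`SoloBlindBhattacharyya` (affinity sandwich) and `SoloBlindEntropicPenroseOnsager`
(`1 - KL/2 ≤ BC`).  Here the sharp monotonicity `D_{1/2} ≤ KL` of Rényi divergences is proved in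
the form

* `exp_neg_klDiv_div_two_le_lintegral_sqrt` : `exp(-KL(q·m ‖ p·m)/2) ≤ ∫ √(q p) dm`
  (Jensen / tangent-line argument for `exp` under `q·m`), and the same with the two arguments
  of `KL` exchanged (`exp_neg_klDiv_symm_div_two_le_lintegral_sqrt`);

and, for an `(n+1)`-body amplitude `Φ ≥ 0` with Born law `𝐏` and one-particle resampling
`𝐐 = g² ⊗ P̂` (notation of `SoloBlindEntropicPenroseOnsager`),

* `mul_exp_neg_le_maxOccupation_of_klDiv_le` : `KL(𝐐 ‖ 𝐏) ≤ K` implies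
  `(n+1) · e^{-K} ≤ maxOccupation (n+1) Φ`;
* `mul_exp_neg_le_maxOccupation_of_klDiv_symm_le` : `KL(𝐏 ‖ 𝐐) ≤ K` implies the same.
  With `g²` the one-particle density of `𝐏`, `KL(𝐏 ‖ 𝐐)` is the mutual information between one
  particle and the other `n` under `|Φ|²`; so a bound on this one-vs-rest mutual information that
  is uniform in the particle number gives macroscopic occupation `≥ e^{-K} · N` of the mode `g`
  (this direction is finite even for hard cores, where `KL(𝐐 ‖ 𝐏) = ∞`).
-/

open MeasureTheory InformationTheory
open scoped ENNReal

namespace Summit.AtomisticToContinuum.BoseEinsteinCondensation.Theorems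

section Abstract

variable {γ : Type*} [MeasurableSpace γ]

/-- Real identity: for `p', q' > 0`, `q' · exp(-log(q'/p')/2) = √q' · √p'`. -/
theorem mul_exp_neg_log_div_div_two {p' q' : ℝ} (hp : 0 < p') (hq : 0 < q') :
    q' * Real.exp (-Real.log (q' / p') / 2) = Real.sqrt q' * Real.sqrt p' := by
  have h1 : -Real.log (q' / p') / 2 = Real.log (p' / q') * (1 / 2) := by
    rw [Real.log_div hq.ne' hp.ne', Real.log_div hp.ne' hq.ne']; ring
  rw [h1, ← Real.rpow_def_of_pos (div_pos hp hq), ← Real.sqrt_eq_rpow, Real.sqrt_div hp.le]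
  calc q' * (Real.sqrt p' / Real.sqrt q') = q' / Real.sqrt q' * Real.sqrt p' := by ring
    _ = Real.sqrt q' * Real.sqrt p' := by rw [Real.div_sqrt]

/-- If `q·m ≪ p·m` then `q = 0` `m`-a.e. on `{p = 0}`. -/
theorem ae_eq_zero_of_withDensity_ac (m : Measure γ) {p q : γ → ℝ≥0∞} (hp : Measurable p)
    (hq : Measurable q) (hac : m.withDensity q ≪ m.withDensity p) :
    ∀ᵐ x ∂m, p x = 0 → q x = 0 := by
  have hs : MeasurableSet {x | p x = 0} := hp (measurableSet_singleton 0)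
  have hPs : m.withDensity p {x | p x = 0} = 0 := by
    rw [withDensity_apply _ hs]
    have : ∫⁻ x in {x | p x = 0}, p x ∂m = ∫⁻ x in {x | p x = 0}, 0 ∂m :=
      setLIntegral_congr_fun hs (fun x hx => hx)
    simpa using this
  have hQs : ∫⁻ x in {x | p x = 0}, q x ∂m = 0 := by
    have := hac hPs
    rwa [withDensity_apply _ hs] at this
  have h1 : q =ᵐ[m.restrict {x | p x = 0}] 0 :=
    (lintegral_eq_zero_iff' hq.aemeasurable).mp hQs
  exact (ae_restrict_iff' hs).mp h1

/-- The Radon–Nikodym derivative of `q·m` against `p·m` is `q/p`, `m`-a.e. on `{p ≠ 0}`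
(for `p` with finite integral and `q·m ≪ p·m`). -/
theorem rnDeriv_withDensity_withDensity_ae (m : Measure γ) {p q : γ → ℝ≥0∞} (hp : Measurable p)
    (hq : Measurable q) (hp1 : ∫⁻ x, p x ∂m ≠ ∞) (hac : m.withDensity q ≪ m.withDensity p) :
    ∀ᵐ x ∂m, p x ≠ 0 → (m.withDensity q).rnDeriv (m.withDensity p) x = q x / p x := by
  haveI : IsFiniteMeasure (m.withDensity p) := isFiniteMeasure_withDensity hp1
  have hp_top : ∀ᵐ x ∂m, p x < ∞ := ae_lt_top hp hp1
  have hpq := ae_eq_zero_of_withDensity_ac m hp hq hac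
  have hqp : Measurable (q / p) := hq.div hp
  have h_ae : q =ᵐ[m] p * (q / p) := by
    filter_upwards [hp_top, hpq] with x hxt hx0
    simp only [Pi.mul_apply, Pi.div_apply]
    by_cases h0 : p x = 0
    · simp [h0, hx0 h0]
    · rw [ENNReal.mul_div_cancel h0 hxt.ne]
  have hQeq : m.withDensity q = (m.withDensity p).withDensity (q / p) := by
    rw [← withDensity_mul _ hp hqp]
    exact withDensity_congr_ae h_ae
  have h1 : (m.withDensity q).rnDeriv (m.withDensity p) =ᵐ[m.withDensity p] (q / p) := by
    rw [hQeq]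
    exact Measure.rnDeriv_withDensity _ hqp
  exact (ae_withDensity_iff hp).mp h1

/-- **Rényi-½ below Kullback–Leibler, exponential form** (`BC ≥ e^{-KL/2}`): for probability
densities `p, q` against `m` with `KL(q·m ‖ p·m) < ∞`,
`exp(-KL(q·m ‖ p·m)/2) ≤ ∫ √(q p) dm`.  Proof: Jensen for `exp` under `q·m` applied to
`-½ log(dQ/dP)`, in the tangent-line form `e^{a}(1 + u - a) ≤ e^{u}`. -/
theorem exp_neg_klDiv_div_two_le_lintegral_sqrt (m : Measure γ) {p q : γ → ℝ≥0∞}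
    (hp : Measurable p) (hq : Measurable q) (hp1 : ∫⁻ x, p x ∂m = 1) (hq1 : ∫⁻ x, q x ∂m = 1)
    (hKL : klDiv (m.withDensity q) (m.withDensity p) ≠ ∞) :
    ENNReal.ofReal (Real.exp (-(klDiv (m.withDensity q) (m.withDensity p)).toReal / 2)) ≤
      ∫⁻ x, (q x * p x) ^ (1 / 2 : ℝ) ∂m := by
  set P := m.withDensity p with hP
  set Q := m.withDensity q with hQ
  obtain ⟨hac, hint⟩ := klDiv_ne_top_iff.mp hKL
  have hPu : P Set.univ = 1 := by
    rw [hP, withDensity_apply _ MeasurableSet.univ, Measure.restrict_univ, hp1]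
  have hQu : Q Set.univ = 1 := by
    rw [hQ, withDensity_apply _ MeasurableSet.univ, Measure.restrict_univ, hq1]
  haveI : IsProbabilityMeasure P := ⟨hPu⟩
  haveI : IsProbabilityMeasure Q := ⟨hQu⟩
  -- a.e. facts against `m`
  have hp_top : ∀ᵐ x ∂m, p x < ∞ := ae_lt_top hp (by simp [hp1])
  have hq_top : ∀ᵐ x ∂m, q x < ∞ := ae_lt_top hq (by simp [hq1])
  have hpq : ∀ᵐ x ∂m, p x = 0 → q x = 0 := ae_eq_zero_of_withDensity_ac m hp hq hac
  have hrn : ∀ᵐ x ∂m, p x ≠ 0 → Q.rnDeriv P x = q x / p x :=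
    rnDeriv_withDensity_withDensity_ae m hp hq (by simp [hp1]) hac
  -- the log-likelihood ratio and its mean
  set u : γ → ℝ := fun x => -llr Q P x / 2 with hu
  have hu_int : Integrable u Q := (hint.neg).div_const 2
  set a : ℝ := ∫ x, u x ∂Q with ha
  have hKLa : -(klDiv Q P).toReal / 2 = a := by
    rw [toReal_klDiv_of_measure_eq hac (by rw [hQu, hPu]), ha, hu, integral_div, integral_neg]
  rw [hKLa]
  -- tangent line of `exp` at `a`
  set T : γ → ℝ := fun x => Real.exp a * (u x - a + 1) with hT
  have hT_int : Integrable T Q :=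
    ((hu_int.sub (integrable_const a)).add (integrable_const 1)).const_mul (Real.exp a)
  have hT_le : ∀ x, T x ≤ Real.exp (u x) := by
    intro x
    have h1 : u x - a + 1 ≤ Real.exp (u x - a) := by
      linarith [Real.add_one_le_exp (u x - a)]
    calc T x = Real.exp a * (u x - a + 1) := rfl
      _ ≤ Real.exp a * Real.exp (u x - a) :=
          mul_le_mul_of_nonneg_left h1 (Real.exp_pos a).le
      _ = Real.exp (u x) := by rw [← Real.exp_add]; ring_nf
  have hi1 : Integrable (fun x => u x - a) Q := hu_int.sub (integrable_const a)
  have hTa : ∫ x, T x ∂Q = Real.exp a := by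
    rw [hT]
    simp only
    rw [integral_const_mul, integral_add hi1 (integrable_const 1),
      integral_sub hu_int (integrable_const a), integral_const, integral_const]
    simp [ha]
  -- `exp a = ∫ T ≤ ∫ T⁺ = ∫⁻ ofReal T ≤ ∫⁻ ofReal (exp u) dQ`
  have hTpos_int : Integrable (fun x => max (T x) 0) Q := hT_int.pos_part
  have step1 : Real.exp a ≤ ∫ x, max (T x) 0 ∂Q := by
    rw [← hTa]
    exact integral_mono hT_int hTpos_int fun x => le_max_left _ _
  have step2 : ENNReal.ofReal (∫ x, max (T x) 0 ∂Q) = ∫⁻ x, ENNReal.ofReal (T x) ∂Q := by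
    rw [ofReal_integral_eq_lintegral_ofReal hTpos_int (ae_of_all _ fun x => le_max_right _ _)]
    refine lintegral_congr fun x => ?_
    rcases le_total (T x) 0 with h | h
    · rw [max_eq_right h, ENNReal.ofReal_zero, ENNReal.ofReal_of_nonpos h]
    · rw [max_eq_left h]
  have step3 : ∫⁻ x, ENNReal.ofReal (T x) ∂Q ≤ ∫⁻ x, ENNReal.ofReal (Real.exp (u x)) ∂Q :=
    lintegral_mono fun x => ENNReal.ofReal_le_ofReal (hT_le x)
  -- `∫⁻ ofReal (exp u) dQ = ∫⁻ √(q p) dm`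
  have hGm : Measurable fun x => ENNReal.ofReal (Real.exp (u x)) :=
    (((measurable_llr Q P).neg).div_const 2).exp.ennreal_ofReal
  have step4 : ∫⁻ x, ENNReal.ofReal (Real.exp (u x)) ∂Q = ∫⁻ x, (q x * p x) ^ (1 / 2 : ℝ) ∂m := by
    rw [hQ, lintegral_withDensity_eq_lintegral_mul _ hq hGm]
    refine lintegral_congr_ae ?_
    filter_upwards [hp_top, hq_top, hpq, hrn] with x hxp hxq hx0 hxr
    simp only [Pi.mul_apply]
    by_cases hq0 : q x = 0
    · rw [hq0, zero_mul, zero_mul, ENNReal.zero_rpow_of_pos (by norm_num)]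
    have hp0 : p x ≠ 0 := fun h => hq0 (hx0 h)
    -- write `p = ofReal p'`, `q = ofReal q'`
    obtain ⟨p', hp'0, hpe⟩ : ∃ r : ℝ, 0 < r ∧ p x = ENNReal.ofReal r :=
      ⟨(p x).toReal, ENNReal.toReal_pos hp0 hxp.ne, (ENNReal.ofReal_toReal hxp.ne).symm⟩
    obtain ⟨q', hq'0, hqe⟩ : ∃ r : ℝ, 0 < r ∧ q x = ENNReal.ofReal r :=
      ⟨(q x).toReal, ENNReal.toReal_pos hq0 hxq.ne, (ENNReal.ofReal_toReal hxq.ne).symm⟩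
    have hux : u x = -Real.log (q' / p') / 2 := by
      rw [hu]
      simp only [llr]
      rw [hxr hp0, ENNReal.toReal_div, hpe, hqe, ENNReal.toReal_ofReal hp'0.le,
        ENNReal.toReal_ofReal hq'0.le]
    rw [hux, hpe, hqe, ← ENNReal.ofReal_mul hq'0.le, mul_exp_neg_log_div_div_two hp'0 hq'0,
      ← ENNReal.ofReal_mul hq'0.le,
      ENNReal.ofReal_rpow_of_nonneg (mul_nonneg hq'0.le hp'0.le) (by norm_num : (0 : ℝ) ≤ 1 / 2),
      ← Real.sqrt_eq_rpow, Real.sqrt_mul hq'0.le]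
  calc ENNReal.ofReal (Real.exp a) ≤ ENNReal.ofReal (∫ x, max (T x) 0 ∂Q) :=
        ENNReal.ofReal_le_ofReal step1
    _ = ∫⁻ x, ENNReal.ofReal (T x) ∂Q := step2
    _ ≤ ∫⁻ x, ENNReal.ofReal (Real.exp (u x)) ∂Q := step3
    _ = ∫⁻ x, (q x * p x) ^ (1 / 2 : ℝ) ∂m := step4

/-- The same bound with the two arguments of `KL` exchanged (the affinity is symmetric):
`exp(-KL(p·m ‖ q·m)/2) ≤ ∫ √(q p) dm`. -/
theorem exp_neg_klDiv_symm_div_two_le_lintegral_sqrt (m : Measure γ) {p q : γ → ℝ≥0∞}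
    (hp : Measurable p) (hq : Measurable q) (hp1 : ∫⁻ x, p x ∂m = 1) (hq1 : ∫⁻ x, q x ∂m = 1)
    (hKL : klDiv (m.withDensity p) (m.withDensity q) ≠ ∞) :
    ENNReal.ofReal (Real.exp (-(klDiv (m.withDensity p) (m.withDensity q)).toReal / 2)) ≤
      ∫⁻ x, (q x * p x) ^ (1 / 2 : ℝ) ∂m := by
  have h := exp_neg_klDiv_div_two_le_lintegral_sqrt m hq hp hq1 hp1 hKL
  simpa only [mul_comm] using h

/-- `KL(q·m ‖ p·m) ≤ K` gives `e^{-K/2} ≤ ∫ √(q p) dm`. -/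
theorem exp_neg_div_two_le_lintegral_sqrt_of_klDiv_le (m : Measure γ) {p q : γ → ℝ≥0∞}
    (hp : Measurable p) (hq : Measurable q) (hp1 : ∫⁻ x, p x ∂m = 1) (hq1 : ∫⁻ x, q x ∂m = 1)
    {K : ℝ} (hK0 : 0 ≤ K) (hK : klDiv (m.withDensity q) (m.withDensity p) ≤ ENNReal.ofReal K) :
    ENNReal.ofReal (Real.exp (-K / 2)) ≤ ∫⁻ x, (q x * p x) ^ (1 / 2 : ℝ) ∂m := by
  have hKL := ne_top_of_le_ne_top ENNReal.ofReal_ne_top hK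
  have h := exp_neg_klDiv_div_two_le_lintegral_sqrt m hp hq hp1 hq1 hKL
  refine le_trans (ENNReal.ofReal_le_ofReal (Real.exp_le_exp.mpr ?_)) h
  have := ENNReal.toReal_le_of_le_ofReal hK0 hK
  linarith

/-- `KL(p·m ‖ q·m) ≤ K` gives `e^{-K/2} ≤ ∫ √(q p) dm`. -/
theorem exp_neg_div_two_le_lintegral_sqrt_of_klDiv_symm_le (m : Measure γ) {p q : γ → ℝ≥0∞}
    (hp : Measurable p) (hq : Measurable q) (hp1 : ∫⁻ x, p x ∂m = 1) (hq1 : ∫⁻ x, q x ∂m = 1)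
    {K : ℝ} (hK0 : 0 ≤ K) (hK : klDiv (m.withDensity p) (m.withDensity q) ≤ ENNReal.ofReal K) :
    ENNReal.ofReal (Real.exp (-K / 2)) ≤ ∫⁻ x, (q x * p x) ^ (1 / 2 : ℝ) ∂m := by
  have hKL := ne_top_of_le_ne_top ENNReal.ofReal_ne_top hK
  have h := exp_neg_klDiv_symm_div_two_le_lintegral_sqrt m hp hq hp1 hq1 hKL
  refine le_trans (ENNReal.ofReal_le_ofReal (Real.exp_le_exp.mpr ?_)) h
  have := ENNReal.toReal_le_of_le_ofReal hK0 hK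
  linarith

/-- Small-entropy form with the arguments of `KL` exchanged: `1 - KL(p·m ‖ q·m)/2 ≤ ∫ √(q p) dm`. -/
theorem one_sub_klDiv_symm_div_two_le_lintegral_sqrt (m : Measure γ) {p q : γ → ℝ≥0∞}
    (hp : Measurable p) (hq : Measurable q) (hp1 : ∫⁻ x, p x ∂m = 1) (hq1 : ∫⁻ x, q x ∂m = 1) :
    1 - klDiv (m.withDensity p) (m.withDensity q) / 2 ≤ ∫⁻ x, (q x * p x) ^ (1 / 2 : ℝ) ∂m := by
  have h := one_sub_klDiv_div_two_le_lintegral_sqrt m hq hp hq1 hp1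
  simpa only [mul_comm] using h

end Abstract

section BoseGas

open Literature.MathematicalPhysics.QuantumManyBody.BoseGas

/-- Common core of the two criteria below: any lower bound `b ≤ ∫√(d𝐐 d𝐏)` on the product-space
affinity of the Born law `𝐏` of `Φ ≥ 0` and its one-particle resampling `𝐐 = g² ⊗ P̂` gives
`(n+1) b² ≤ maxOccupation (n+1) Φ`. -/
theorem mul_sq_le_maxOccupation_of_le_affinity {n : ℕ} {g : Space → ℝ}
    {Φ : Config (n + 1) → ℝ} (hg0 : 0 ≤ g) (hΦ0 : 0 ≤ Φ) (hgm : Measurable g) (hΦm : Measurable Φ)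
    (hint : ∀ Y : Config n, Integrable (fun x => g x * Φ (Matrix.vecCons x Y)))
    (hg1 : ∫⁻ x, ENNReal.ofReal (g x) ^ 2 = 1)
    (hΦ1 : ∫⁻ Y : Config n, ∫⁻ x, ENNReal.ofReal (Φ (Matrix.vecCons x Y)) ^ 2 = 1) {b : ℝ≥0∞}
    (hb : b ≤ ∫⁻ z, ((ENNReal.ofReal (g z.1) ^ 2 *
        ∫⁻ y, ENNReal.ofReal (Φ (Matrix.vecCons y z.2)) ^ 2) *
        ENNReal.ofReal (Φ (Matrix.vecCons z.1 z.2)) ^ 2) ^ (1 / 2 : ℝ)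
        ∂((volume : Measure Space).prod (volume : Measure (Config n)))) :
    (n + 1 : ℝ≥0∞) * b ^ 2 ≤ maxOccupation (n + 1) (fun X => (Φ X : ℂ)) := by
  set Ψ : Space → Config n → ℝ≥0∞ := fun y c => ENNReal.ofReal (Φ (Matrix.vecCons y c)) with hΨ
  set φ : Space → ℝ≥0∞ := fun y => ENNReal.ofReal (g y) with hφ
  have hΨm : Measurable (Function.uncurry Ψ) :=
    (hΦm.comp measurable_vecCons).ennreal_ofReal
  have hφm : Measurable φ := hgm.ennreal_ofReal
  have hid := lintegral_sqrt_densities_eq (volume : Measure Space) (volume : Measure (Config n))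
    hΨm hφm
  have hb' : b ≤ ∫⁻ c, (∫⁻ y, φ y * Ψ y c) * (∫⁻ y, Ψ y c ^ 2) ^ (1 / 2 : ℝ) := by
    rw [← hid]
    exact hb.trans (le_of_eq (lintegral_congr fun z => rfl))
  have hsand := bhattacharyya_sq_le_maxOccupation hg0 hΦ0 hgm hΦm hint hg1 hΦ1
  refine le_trans ?_ hsand
  exact mul_le_mul' le_rfl (pow_le_pow_left' hb' 2)

/-- Normalisation of the Born density `Φ(x :: Y)²` on `Space × Config n` (Tonelli). -/
theorem lintegral_born_eq_one {n : ℕ} {Φ : Config (n + 1) → ℝ} (hΦm : Measurable Φ)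
    (hΦ1 : ∫⁻ Y : Config n, ∫⁻ x, ENNReal.ofReal (Φ (Matrix.vecCons x Y)) ^ 2 = 1) :
    ∫⁻ z, ENNReal.ofReal (Φ (Matrix.vecCons z.1 z.2)) ^ 2
      ∂((volume : Measure Space).prod (volume : Measure (Config n))) = 1 := by
  have hpm : Measurable fun z : Space × Config n =>
      ENNReal.ofReal (Φ (Matrix.vecCons z.1 z.2)) ^ 2 :=
    ((hΦm.comp measurable_vecCons).ennreal_ofReal).pow_const 2
  rw [lintegral_prod_symm _ hpm.aemeasurable]
  exact hΦ1

/-- Normalisation of the resampled density `g(x)² · P̂(Y)` on `Space × Config n` (Tonelli). -/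
theorem lintegral_resampled_eq_one {n : ℕ} {g : Space → ℝ} {Φ : Config (n + 1) → ℝ}
    (hgm : Measurable g) (hΦm : Measurable Φ) (hg1 : ∫⁻ x, ENNReal.ofReal (g x) ^ 2 = 1)
    (hΦ1 : ∫⁻ Y : Config n, ∫⁻ x, ENNReal.ofReal (Φ (Matrix.vecCons x Y)) ^ 2 = 1) :
    ∫⁻ z, ENNReal.ofReal (g z.1) ^ 2 * (∫⁻ y, ENNReal.ofReal (Φ (Matrix.vecCons y z.2)) ^ 2)
      ∂((volume : Measure Space).prod (volume : Measure (Config n))) = 1 := by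
  have hpm : Measurable fun z : Space × Config n =>
      ENNReal.ofReal (Φ (Matrix.vecCons z.1 z.2)) ^ 2 :=
    ((hΦm.comp measurable_vecCons).ennreal_ofReal).pow_const 2
  have hPhat : Measurable fun c : Config n => ∫⁻ y, ENNReal.ofReal (Φ (Matrix.vecCons y c)) ^ 2 :=
    hpm.lintegral_prod_left'
  have hqm : Measurable fun z : Space × Config n =>
      ENNReal.ofReal (g z.1) ^ 2 * ∫⁻ y, ENNReal.ofReal (Φ (Matrix.vecCons y z.2)) ^ 2 :=
    ((hgm.ennreal_ofReal.comp measurable_fst).pow_const 2).mul (hPhat.comp measurable_snd)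
  rw [lintegral_prod _ hqm.aemeasurable]
  have hPhat1 : ∫⁻ c : Config n, ∫⁻ y, ENNReal.ofReal (Φ (Matrix.vecCons y c)) ^ 2 = 1 := hΦ1
  have h1 : ∀ x : Space, ∫⁻ c : Config n, ENNReal.ofReal (g x) ^ 2 *
      (∫⁻ y, ENNReal.ofReal (Φ (Matrix.vecCons y c)) ^ 2) = ENNReal.ofReal (g x) ^ 2 := by
    intro x
    rw [lintegral_const_mul _ hPhat, hPhat1, mul_one]
  calc _ = ∫⁻ x, ENNReal.ofReal (g x) ^ 2 := lintegral_congr fun x => h1 x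
    _ = 1 := hg1

/-- **Entropic Penrose–Onsager criterion, exponential form.** With `𝐏` the Born law of the
`(n+1)`-body amplitude `Φ ≥ 0` on `Space × Config n` and `𝐐 = g² ⊗ P̂` its one-particle
resampling by the normalised mode `g ≥ 0`: if `KL(𝐐 ‖ 𝐏) ≤ K` then
`(n+1) · e^{-K} ≤ maxOccupation (n+1) Φ`. -/
theorem mul_exp_neg_le_maxOccupation_of_klDiv_le {n : ℕ} {g : Space → ℝ}
    {Φ : Config (n + 1) → ℝ} (hg0 : 0 ≤ g) (hΦ0 : 0 ≤ Φ) (hgm : Measurable g) (hΦm : Measurable Φ)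
    (hint : ∀ Y : Config n, Integrable (fun x => g x * Φ (Matrix.vecCons x Y)))
    (hg1 : ∫⁻ x, ENNReal.ofReal (g x) ^ 2 = 1)
    (hΦ1 : ∫⁻ Y : Config n, ∫⁻ x, ENNReal.ofReal (Φ (Matrix.vecCons x Y)) ^ 2 = 1)
    {K : ℝ} (hK0 : 0 ≤ K)
    (hK : klDiv
        (((volume : Measure Space).prod (volume : Measure (Config n))).withDensity
          fun z => ENNReal.ofReal (g z.1) ^ 2 *
            ∫⁻ y, ENNReal.ofReal (Φ (Matrix.vecCons y z.2)) ^ 2)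
        (((volume : Measure Space).prod (volume : Measure (Config n))).withDensity
          fun z => ENNReal.ofReal (Φ (Matrix.vecCons z.1 z.2)) ^ 2) ≤ ENNReal.ofReal K) :
    (n + 1 : ℝ≥0∞) * ENNReal.ofReal (Real.exp (-K)) ≤
      maxOccupation (n + 1) (fun X => (Φ X : ℂ)) := by
  have hpm : Measurable fun z : Space × Config n =>
      ENNReal.ofReal (Φ (Matrix.vecCons z.1 z.2)) ^ 2 :=
    ((hΦm.comp measurable_vecCons).ennreal_ofReal).pow_const 2
  have hPhat : Measurable fun c : Config n => ∫⁻ y, ENNReal.ofReal (Φ (Matrix.vecCons y c)) ^ 2 :=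
    hpm.lintegral_prod_left'
  have hqm : Measurable fun z : Space × Config n =>
      ENNReal.ofReal (g z.1) ^ 2 * ∫⁻ y, ENNReal.ofReal (Φ (Matrix.vecCons y z.2)) ^ 2 :=
    ((hgm.ennreal_ofReal.comp measurable_fst).pow_const 2).mul (hPhat.comp measurable_snd)
  have hp1 := lintegral_born_eq_one hΦm hΦ1
  have hq1 := lintegral_resampled_eq_one hgm hΦm hg1 hΦ1
  have hexp := exp_neg_div_two_le_lintegral_sqrt_of_klDiv_le
    ((volume : Measure Space).prod (volume : Measure (Config n))) hpm hqm hp1 hq1 hK0 hK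
  have h := mul_sq_le_maxOccupation_of_le_affinity hg0 hΦ0 hgm hΦm hint hg1 hΦ1 hexp
  have hsq : ENNReal.ofReal (Real.exp (-K / 2)) ^ 2 = ENNReal.ofReal (Real.exp (-K)) := by
    rw [← ENNReal.ofReal_pow (Real.exp_pos _).le, sq, ← Real.exp_add]
    ring_nf
  rwa [hsq] at h

/-- **Mutual-information form.** Same setting; if `KL(𝐏 ‖ 𝐐) ≤ K` then
`(n+1) · e^{-K} ≤ maxOccupation (n+1) Φ`.  When `g²` is the one-particle density of `𝐏`,
`KL(𝐏 ‖ g² ⊗ P̂)` is the mutual information `I(x₁ ; X̂)` between one particle and the rest, and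
in general `KL(𝐏 ‖ g² ⊗ P̂) = I(x₁ ; X̂) + KL(𝐏₁ ‖ g²) ≥ I(x₁ ; X̂)`. -/
theorem mul_exp_neg_le_maxOccupation_of_klDiv_symm_le {n : ℕ} {g : Space → ℝ}
    {Φ : Config (n + 1) → ℝ} (hg0 : 0 ≤ g) (hΦ0 : 0 ≤ Φ) (hgm : Measurable g) (hΦm : Measurable Φ)
    (hint : ∀ Y : Config n, Integrable (fun x => g x * Φ (Matrix.vecCons x Y)))
    (hg1 : ∫⁻ x, ENNReal.ofReal (g x) ^ 2 = 1)
    (hΦ1 : ∫⁻ Y : Config n, ∫⁻ x, ENNReal.ofReal (Φ (Matrix.vecCons x Y)) ^ 2 = 1)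
    {K : ℝ} (hK0 : 0 ≤ K)
    (hK : klDiv
        (((volume : Measure Space).prod (volume : Measure (Config n))).withDensity
          fun z => ENNReal.ofReal (Φ (Matrix.vecCons z.1 z.2)) ^ 2)
        (((volume : Measure Space).prod (volume : Measure (Config n))).withDensity
          fun z => ENNReal.ofReal (g z.1) ^ 2 *
            ∫⁻ y, ENNReal.ofReal (Φ (Matrix.vecCons y z.2)) ^ 2) ≤ ENNReal.ofReal K) :
    (n + 1 : ℝ≥0∞) * ENNReal.ofReal (Real.exp (-K)) ≤
      maxOccupation (n + 1) (fun X => (Φ X : ℂ)) := by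
  have hpm : Measurable fun z : Space × Config n =>
      ENNReal.ofReal (Φ (Matrix.vecCons z.1 z.2)) ^ 2 :=
    ((hΦm.comp measurable_vecCons).ennreal_ofReal).pow_const 2
  have hPhat : Measurable fun c : Config n => ∫⁻ y, ENNReal.ofReal (Φ (Matrix.vecCons y c)) ^ 2 :=
    hpm.lintegral_prod_left'
  have hqm : Measurable fun z : Space × Config n =>
      ENNReal.ofReal (g z.1) ^ 2 * ∫⁻ y, ENNReal.ofReal (Φ (Matrix.vecCons y z.2)) ^ 2 :=
    ((hgm.ennreal_ofReal.comp measurable_fst).pow_const 2).mul (hPhat.comp measurable_snd)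
  have hp1 := lintegral_born_eq_one hΦm hΦ1
  have hq1 := lintegral_resampled_eq_one hgm hΦm hg1 hΦ1
  have hexp := exp_neg_div_two_le_lintegral_sqrt_of_klDiv_symm_le
    ((volume : Measure Space).prod (volume : Measure (Config n))) hpm hqm hp1 hq1 hK0 hK
  have h := mul_sq_le_maxOccupation_of_le_affinity hg0 hΦ0 hgm hΦm hint hg1 hΦ1 hexp
  have hsq : ENNReal.ofReal (Real.exp (-K / 2)) ^ 2 = ENNReal.ofReal (Real.exp (-K)) := by
    rw [← ENNReal.ofReal_pow (Real.exp_pos _).le, sq, ← Real.exp_add]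
    ring_nf
  rwa [hsq] at h

/-- **Mutual-information form, small-information version** (no finiteness hypothesis):
`(n+1) · (1 - KL(𝐏 ‖ 𝐐)/2)² ≤ maxOccupation (n+1) Φ`. -/
theorem mul_one_sub_klDiv_symm_sq_le_maxOccupation {n : ℕ} {g : Space → ℝ}
    {Φ : Config (n + 1) → ℝ} (hg0 : 0 ≤ g) (hΦ0 : 0 ≤ Φ) (hgm : Measurable g) (hΦm : Measurable Φ)
    (hint : ∀ Y : Config n, Integrable (fun x => g x * Φ (Matrix.vecCons x Y)))
    (hg1 : ∫⁻ x, ENNReal.ofReal (g x) ^ 2 = 1)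
    (hΦ1 : ∫⁻ Y : Config n, ∫⁻ x, ENNReal.ofReal (Φ (Matrix.vecCons x Y)) ^ 2 = 1) :
    (n + 1 : ℝ≥0∞) *
        (1 - klDiv
            (((volume : Measure Space).prod (volume : Measure (Config n))).withDensity
              fun z => ENNReal.ofReal (Φ (Matrix.vecCons z.1 z.2)) ^ 2)
            (((volume : Measure Space).prod (volume : Measure (Config n))).withDensity
              fun z => ENNReal.ofReal (g z.1) ^ 2 *
                ∫⁻ y, ENNReal.ofReal (Φ (Matrix.vecCons y z.2)) ^ 2) / 2) ^ 2 ≤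
      maxOccupation (n + 1) (fun X => (Φ X : ℂ)) := by
  have hpm : Measurable fun z : Space × Config n =>
      ENNReal.ofReal (Φ (Matrix.vecCons z.1 z.2)) ^ 2 :=
    ((hΦm.comp measurable_vecCons).ennreal_ofReal).pow_const 2
  have hPhat : Measurable fun c : Config n => ∫⁻ y, ENNReal.ofReal (Φ (Matrix.vecCons y c)) ^ 2 :=
    hpm.lintegral_prod_left'
  have hqm : Measurable fun z : Space × Config n =>
      ENNReal.ofReal (g z.1) ^ 2 * ∫⁻ y, ENNReal.ofReal (Φ (Matrix.vecCons y z.2)) ^ 2 :=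
    ((hgm.ennreal_ofReal.comp measurable_fst).pow_const 2).mul (hPhat.comp measurable_snd)
  have hp1 := lintegral_born_eq_one hΦm hΦ1
  have hq1 := lintegral_resampled_eq_one hgm hΦm hg1 hΦ1
  have hBC := one_sub_klDiv_symm_div_two_le_lintegral_sqrt
    ((volume : Measure Space).prod (volume : Measure (Config n))) hpm hqm hp1 hq1
  exact mul_sq_le_maxOccupation_of_le_affinity hg0 hΦ0 hgm hΦm hint hg1 hΦ1 hBC

end BoseGas

end Summit.AtomisticToContinuum.BoseEinsteinCondensation.Theorems
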